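import Mathlib
import Literature.Dynamics.ConleyIndex.WazewskiPrinciple
import HarnessLib

/-!
# A block with a uniformly drifting bounded observable carries no Ważewski pair
# (crux stmt-AnomalousDissipation-10352 `WazewskiBlock.UniformGalerkinTrap`, line `Sketch`, lead c2 — negative tool)

The bet of the line `Sketch` (`Cruxes/UniformGalerkinTrap/Lines/Sketch.lean`, `stub_wazewskiBlock`) asks that the three-face
block `B = {KE ≤ E, W ≥ ε₀, Z ≤ G} ∩ {mean 0}` of the Galerkin phase flow have a CLOSED immediate exit set onto which `B` does
not retract.  Below the energy/dissipation ridge — enstrophy caps with `νG < ε₀` — the energy is a strict Lyapunov function on the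
block (`d/dt KE = W − νZ ≥ ε₀ − νG > 0`, landed stub p108219), so no forward orbit stays in `B`, and Ważewski's retract principle
(tree engine `IsSemiflow.exists_forall_mem_of_not_retract`, PROVED), read contrapositively, forbids the pair.  This file isolates
that contrapositive as a structure-free lemma over the tree's Conley-index vocabulary, usable against any proposed block:

* `not_exists_trapped_of_drift` — if a continuous observable `L`, bounded above on `W`, has flow-derivative `≥ κ > 0` at every
  point of `W`, then no point of `W` has its whole forward orbit in `W`;
* `noWazewskiPair_of_drift` — hence, for closed `W`, it is NOT the case that `W⁻` is closed and `W` does not retract onto `W⁻`.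

(Lemma 2 of the lead's dossier `Cruxes/UniformGalerkinTrap/Lines/SketchDead.md`; the case `νG < ε₀` of its Theorem 1.)
References: T. Ważewski, Ann. Soc. Polon. Math. 20 (1947) 279–313; C. Conley, CBMS 38 (1978), Ch. II.
-/

-- `Summit.<Summit>.<Problem>` is the tree's mandated summit-side namespace (CONVENTIONS §2); deliberate duplicate.
set_option linter.dupNamespace false

namespace Summit.AnomalousDissipation.AnomalousDissipation.Theorems.UniformGalerkinTrap.Sketch

open Set Filter Topology
open Literature.Dynamics.ConleyIndex

variable {X : Type*} [TopologicalSpace X] {φ : ℝ → X → X}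

/-- **Uniform drift empties the block.** Let `φ` be a continuous semiflow, `W ⊆ X`, `L : X → ℝ` continuous with `L ≤ M` on `W`,
and suppose that along every orbit `s ↦ L (φ s x)` has derivative `d (φ t x)` at each `t > 0`, with `d ≥ κ > 0` on `W`.  Then no
point of `W` has `φ t x ∈ W` for all `t ≥ 0` (along such an orbit `L` would grow at least linearly, `L (φ t x) ≥ L x + κ t`, and
exceed `M`). [folklore] -/
theorem not_exists_trapped_of_drift (hφ : IsSemiflow φ) {W : Set X} {L d : X → ℝ} (hL : Continuous L)
    {κ M : ℝ} (hκ : 0 < κ)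
    (hder : ∀ (x : X) (t : ℝ), 0 < t → HasDerivAt (fun s => L (φ s x)) (d (φ t x)) t)
    (hd : ∀ x ∈ W, κ ≤ d x) (hM : ∀ x ∈ W, L x ≤ M) :
    ¬ ∃ x ∈ W, ∀ t : ℝ, 0 ≤ t → φ t x ∈ W := by
  rintro ⟨x, hx, htrap⟩
  set g : ℝ → ℝ := fun s => L (φ s x) with hg
  have hcont : ContinuousOn g (Ici 0) := hL.comp_continuousOn (hφ.continuousOn_orbit x)
  have hdiff : DifferentiableOn ℝ g (interior (Ici (0 : ℝ))) := by
    rw [interior_Ici]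
    intro t ht
    exact (hder x t ht).differentiableAt.differentiableWithinAt
  have hge : ∀ t ∈ interior (Ici (0 : ℝ)), κ ≤ deriv g t := by
    rw [interior_Ici]
    intro t ht
    rw [(hder x t ht).deriv]
    exact hd _ (htrap t (le_of_lt ht))
  have hmono := (convex_Ici (0 : ℝ)).mul_sub_le_image_sub_of_le_deriv hcont hdiff hge
  set T : ℝ := (M - L x) / κ + 1 with hT
  have hLx : L x ≤ M := hM x hx
  have hT0 : 0 ≤ T := by
    have : 0 ≤ (M - L x) / κ := div_nonneg (sub_nonneg.2 hLx) hκ.le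
    linarith
  have h1 := hmono 0 self_mem_Ici T hT0 hT0
  have hg0 : g 0 = L x := by simp [hg, hφ.map_zero]
  have hgT : g T ≤ M := hM _ (htrap T hT0)
  have hκT : κ * (T - 0) = (M - L x) + κ := by
    rw [sub_zero, hT, mul_add, mul_one, mul_div_cancel₀ _ hκ.ne']
  rw [hκT, hg0] at h1
  linarith

/-- **No Ważewski pair under uniform drift.** Under the hypotheses of `not_exists_trapped_of_drift`, if moreover `W` is closed,
then it is NOT the case that the immediate exit set `W⁻` is closed and `W` does not retract onto `W⁻` (no map continuous on `W`,
into `W⁻`, fixing `W⁻` pointwise) — for otherwise Ważewski's retract principle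
(`IsSemiflow.exists_forall_mem_of_not_retract`) would produce a forward orbit staying in `W`.  Applied to the three-face block of
crux stmt-AnomalousDissipation-10352 with `L = KE`, `d = W − νZ`, `κ = ε₀ − νG > 0`, `M = E`, this is the case `νG < ε₀` of the
refutation of the line `Sketch`'s bet. [cite: Conley1978, Ch. II §2] -/
theorem noWazewskiPair_of_drift :
    ∀ {X : Type} [TopologicalSpace X] (φ : ℝ → X → X) (W : Set X) (L d : X → ℝ) (κ M : ℝ),
      IsSemiflow φ → IsClosed W → Continuous L → 0 < κ →
      (∀ (x : X) (t : ℝ), 0 < t → HasDerivAt (fun s => L (φ s x)) (d (φ t x)) t) →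
      (∀ x ∈ W, κ ≤ d x) → (∀ x ∈ W, L x ≤ M) →
      ¬ (IsClosed (immediateExitSet φ W) ∧
          ¬ ∃ r : X → X, ContinuousOn r W ∧ MapsTo r W (immediateExitSet φ W) ∧
            ∀ x ∈ immediateExitSet φ W, r x = x) := by
  intro X _ φ W L d κ M hφ hW hL hκ hder hd hM
  rintro ⟨hclosed, hnr⟩
  exact not_exists_trapped_of_drift hφ hL hκ hder hd hM (hφ.exists_forall_mem_of_not_retract hW hclosed hnr)

end Summit.AnomalousDissipation.AnomalousDissipation.Theorems.UniformGalerkinTrap.Sketch
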